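import Summits.PneNP.PneNP.Theorems.ExpanderLinearGeneratorsResolutionNFreeColumnMaster
import Summits.PneNP.PneNP.Theorems.ExpanderLinearGeneratorsResolutionNFreeLaw
import Literature.Barriers.ValiantsHypothesis.MonotoneGapSensitive
import HarnessLib

/-!
# The n-free resolution-size rung for expanding linear systems, XII: the exponential law at bounded column weight

Support file for crux `stmt-PneNP-11442`
(`Summit.PneNP.PneNP.Theses.ExpanderLinearGenerators.ExpansionForcesDepthFregeSize`, the
EXPANSION-SCALE LAW: proofs of the XOR-CNF of an unsolvable `ℓ`-sparse `(r, 3ℓ/4)`-boundary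
expander have size `≥ 2^{r^ε}`, uniformly in the numbers `n` of variables and `m` of rows).

At the RESOLUTION rung the tree so far holds, n-free: the width law, the POLYNOMIAL size law
`|π| ≥ r^{(1-ε)⌈3ℓ/4⌉}/2^{ℓ+1}` (file IV, `resolution_size_nfree`) and EXPONENTIAL size laws for
twin-closed systems and for the 2-bit encoding (files VI, VII). This file proves the n-free,
m-free EXPONENTIAL law for the 1-bit encoding under ONE structural hypothesis, bounded COLUMN
WEIGHT (`resolution_size_nfree_column`):

  for `ℓ ≥ 1`, `0 < ε < 1`, real `r ≥ 4`, any `n, m`, every `ℓ`-sparse `E : Fin m → LinEqMod 2 n`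
  whose supports form an `(r, 3ℓ/4)`-boundary expander and in which every variable lies in at
  most `Δ ≤ r^{(1-ε)ℓ/2 - 1}/2^ℓ` rows, every resolution refutation `π` of `sumEncoding 1 E` has
  `|π| ≥ 2^{r^ε/(128 ℓ) - 1}`;

and its crux-shaped corollary `resolution_size_column_pow`: for every `ℓ` and every column-weight
exponent `0 ≤ a < ℓ/2 - 1` there are `ε > 0` and `R` with `|π| ≥ 2^{r^ε}` for all `r ≥ R` whenever
the column weight is `≤ r^a`. So the n-free exponential resolution law ("Q(ℓ)" of the s26 memo on
the item) can only fail through HEAVY variables — of column weight `r^{Ω(ℓ)}` — and in particular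
holds for all bounded-degree systems (e.g. Tseitin formulas of degree-`ℓ` graphs all of whose
vertex sets of size `≤ r` have `≥ 3ℓ/4` boundary edges per vertex: `|π| ≥ 2^{Ω(r^{1-2/ℓ-o(1)})}`,
with no reference to the size of the graph).

Proof: the altered master inequality of file XI with `L = ⌈3ℓ/4⌉ - 1`, `W = ⌈(3ℓ/4 - L) r/2⌉ - 1`,
`K + 1 = ⌈r^{1-ε}⌉`, `s = ⌊r^ε/(128ℓ)⌋ + 1`: the first term is `≤ 2^{r^ε/128} e^{-r^ε/64}`, the
second `≤ 2^{-s}` because `(K+1)^{(L+1)s+⌈cs⌉-ℓs} ≥ r^{(1-ε)ℓ s/2}` absorbs `(QΔ2^ℓ)^s`.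

References: E. Ben-Sasson, A. Wigderson, J. ACM 48 (2001), §3, §6, Thm. 6.5; P. Beame,
T. Pitassi, FOCS 1996; N. Alon, J. Spencer, *The probabilistic method*, §3; J. Krajíček, *Proof
complexity* (CUP 2019), Lemma 13.4.5, Cor. 13.4.6 (the n-dependent law), Problem 19.4.5.
-/

namespace Summit.PneNP.PneNP.Theorems.ResNFree

set_option linter.dupNamespace false -- `Summit.PneNP.PneNP.…`: summit = sub-problem (D-0017)

open Finset Filter Topology Literature.Computability.Complexity Literature.Computability.MetaComplexity
open Summit.PneNP.PneNP.Theorems.ResKRestriction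
open Literature.Barriers.ValiantsHypothesis (two_rpow_le_exp)

/-- The killing estimate of the restriction method: with sampling rate `1/(K+1)`,
`K + 1 ≤ r^{1-ε} + 1`, a line with `q ≥ r/16` free variables survives unsatisfied with probability
`≤ ((2K+1)/(2K+2))^q ≤ exp(-r^ε/64)`. [Beame–Pitassi 1996] [folklore] -/
theorem ratio_pow_le_exp_neg {K q : ℕ} {r ε : ℝ} (hr : 1 ≤ r) (hε : ε ≤ 1)
    (hK : (K : ℝ) + 1 ≤ r ^ (1 - ε) + 1) (hq : r / 16 ≤ (q : ℝ)) :
    ((2 * (K : ℝ) + 1) / (2 * K + 2)) ^ q ≤ Real.exp (-(r ^ ε) / 64) := by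
  have hr0 : 0 < r := by linarith
  have hK0 : (0 : ℝ) < 2 * (K : ℝ) + 2 := by positivity
  have hbase : (2 * (K : ℝ) + 1) / (2 * K + 2) = -(1 / (2 * K + 2)) + 1 := by
    field_simp; ring
  have hbase_le : (2 * (K : ℝ) + 1) / (2 * K + 2) ≤ Real.exp (-(1 / (2 * K + 2))) := by
    rw [hbase]; exact Real.add_one_le_exp _
  have hbase0 : (0 : ℝ) ≤ (2 * (K : ℝ) + 1) / (2 * K + 2) := by positivity
  have hstep1 : ((2 * (K : ℝ) + 1) / (2 * K + 2)) ^ q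
      ≤ Real.exp (-(1 / (2 * K + 2))) ^ q := pow_le_pow_left₀ hbase0 hbase_le _
  have hstep2 : Real.exp (-(1 / (2 * (K : ℝ) + 2))) ^ q
      = Real.exp ((q : ℝ) * -(1 / (2 * K + 2))) := by
    rw [Real.exp_nat_mul]
  have hstep3 : Real.exp ((q : ℝ) * -(1 / (2 * (K : ℝ) + 2))) ≤ Real.exp (-(r ^ ε) / 64) := by
    rw [Real.exp_le_exp]
    have h2K : 2 * (K : ℝ) + 2 ≤ 4 * r ^ (1 - ε) := by
      have : (1 : ℝ) ≤ r ^ (1 - ε) := Real.one_le_rpow hr (by linarith)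
      linarith
    have hprod : r ^ ε * r ^ (1 - ε) = r := by
      rw [← Real.rpow_add hr0]; norm_num
    have hrε : 0 ≤ r ^ ε := (Real.rpow_pos_of_pos hr0 _).le
    have hq' : r ^ ε / 64 ≤ (q : ℝ) / (2 * K + 2) := by
      rw [div_le_div_iff₀ (by norm_num) hK0]
      calc r ^ ε * (2 * (K : ℝ) + 2) ≤ r ^ ε * (4 * r ^ (1 - ε)) :=
            mul_le_mul_of_nonneg_left h2K hrε
        _ = 4 * r := by rw [mul_left_comm, hprod]
        _ ≤ (q : ℝ) * 64 := by linarith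
    have : (q : ℝ) * -(1 / (2 * (K : ℝ) + 2)) = -((q : ℝ) / (2 * K + 2)) := by ring
    rw [this, neg_div]
    exact neg_le_neg hq'
  calc ((2 * (K : ℝ) + 1) / (2 * K + 2)) ^ q
      ≤ Real.exp (-(1 / (2 * K + 2))) ^ q := hstep1
    _ = Real.exp ((q : ℝ) * -(1 / (2 * K + 2))) := hstep2
    _ ≤ Real.exp (-(r ^ ε) / 64) := hstep3

/-- The damage estimate of the altered method: if `K + 1 ≥ r^b` (`r > 0`), the exponent `j` is at least
`ℓ s / 2` and `P · 2^ℓ ≤ r^{bℓ/2}/2`, then `P^s 2^{ℓ s}/(K+1)^j ≤ 2^{-s}`. [folklore] -/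
theorem pow_mul_pow_div_le_half_pow {K ℓ s j P : ℕ} {r b : ℝ} (hr : 0 < r)
    (hK1 : (1 : ℝ) ≤ (K : ℝ) + 1) (hKge : r ^ b ≤ (K : ℝ) + 1)
    (hj : (ℓ : ℝ) * s / 2 ≤ (j : ℝ)) (hP : (P : ℝ) * 2 ^ ℓ ≤ r ^ (b * ℓ / 2) / 2) :
    (P : ℝ) ^ s * (2 : ℝ) ^ (ℓ * s) / ((K : ℝ) + 1) ^ j ≤ (1 / 2 : ℝ) ^ s := by
  have hrb : 0 ≤ r ^ b := Real.rpow_nonneg hr.le b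
  -- denominator
  have hden : r ^ (b * ℓ * s / 2) ≤ ((K : ℝ) + 1) ^ j := by
    calc r ^ (b * ℓ * s / 2) = (r ^ b) ^ ((ℓ : ℝ) * s / 2) := by
          rw [← Real.rpow_mul hr.le]; congr 1; ring
      _ ≤ ((K : ℝ) + 1) ^ ((ℓ : ℝ) * s / 2) := Real.rpow_le_rpow hrb hKge (by positivity)
      _ ≤ ((K : ℝ) + 1) ^ ((j : ℕ) : ℝ) := Real.rpow_le_rpow_of_exponent_le hK1 hj
      _ = ((K : ℝ) + 1) ^ j := Real.rpow_natCast _ _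
  have hden_pos : 0 < r ^ (b * ℓ * s / 2) := Real.rpow_pos_of_pos hr _
  -- numerator
  have hnum : (P : ℝ) ^ s * (2 : ℝ) ^ (ℓ * s) ≤ (r ^ (b * ℓ / 2) / 2) ^ s := by
    rw [pow_mul, ← mul_pow]
    exact pow_le_pow_left₀ (by positivity) hP s
  have hpow_eq : (r ^ (b * ℓ / 2) / 2) ^ s = r ^ (b * ℓ * s / 2) * (1 / 2) ^ s := by
    rw [div_pow, ← Real.rpow_natCast (r ^ (b * ℓ / 2)) s, ← Real.rpow_mul hr.le]
    have : b * ℓ / 2 * (s : ℝ) = b * ℓ * s / 2 := by ring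
    rw [this, one_div, inv_pow, div_eq_mul_inv]
  rw [div_le_iff₀ (lt_of_lt_of_le hden_pos hden)]
  calc (P : ℝ) ^ s * (2 : ℝ) ^ (ℓ * s) ≤ (r ^ (b * ℓ / 2) / 2) ^ s := hnum
    _ = r ^ (b * ℓ * s / 2) * (1 / 2) ^ s := hpow_eq
    _ ≤ ((K : ℝ) + 1) ^ j * (1 / 2) ^ s := mul_le_mul_of_nonneg_right hden (by positivity)
    _ = (1 / 2 : ℝ) ^ s * ((K : ℝ) + 1) ^ j := by ring

/-- **The n-free EXPONENTIAL resolution-size law at bounded column weight (Theorem C).** For every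
locality `ℓ ≥ 1` and `0 < ε < 1`, all real `r ≥ 4`, all `n, m, Δ`, every `ℓ`-sparse system
`E : Fin m → LinEqMod 2 n` whose supports form an `(r, 3ℓ/4)`-boundary expander and whose variables
each lie in at most `Δ ≤ r^{(1-ε)ℓ/2 - 1}/2^ℓ` rows, every resolution refutation of
`sumEncoding 1 E` has at least `2^{r^ε/(128 ℓ) - 1}` lines — independently of `n` and `m`.
[Ben-Sasson–Wigderson 2001, Thm. 6.5; Beame–Pitassi 1996; Alon–Spencer §3; Krajíček 2019, §13.4]
[folklore] -/
theorem resolution_size_nfree_column (ℓ : ℕ) (hℓ : 1 ≤ ℓ) (ε : ℝ) (hε : 0 < ε) (hε1 : ε < 1)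
    (r : ℝ) (hr : 4 ≤ r) (n m Δ : ℕ) (E : Fin m → LinEqMod 2 n)
    (hsparse : ∀ i, (E i).supp.card ≤ ℓ)
    (hexp : IsBoundaryExpander (fun i => (E i).supp.map Fin.valEmbedding) r (3 / 4 * ℓ))
    (hcol : ∀ j : Fin n, ((univ : Finset (Fin m)).filter fun i => j ∈ (E i).supp).card ≤ Δ)
    (hΔ : (Δ : ℝ) ≤ r ^ ((1 - ε) * ℓ / 2 - 1) / 2 ^ ℓ)
    (π : List (ResLine ℕ)) (hπ : IsResRefutation (sumEncoding 1 E) π) :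
    (2 : ℝ) ^ (r ^ ε / (128 * ℓ) - 1) ≤ (π.length : ℝ) := by
  -- the constants `c = 3ℓ/4`, `T = ⌈c⌉`, `L = T - 1`
  set c : ℝ := 3 / 4 * ℓ with hc
  have hℓ' : (1 : ℝ) ≤ ℓ := by exact_mod_cast hℓ
  have hcpos : 0 < c := by rw [hc]; positivity
  set T : ℕ := ⌈c⌉₊ with hT
  have hT1 : 1 ≤ T := Nat.one_le_iff_ne_zero.2 (Nat.ceil_pos.2 hcpos).ne'
  set L : ℕ := T - 1 with hL
  have hLT : L + 1 = T := Nat.sub_add_cancel hT1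
  have hLreal : (L : ℝ) = T - 1 := by
    have : ((L + 1 : ℕ) : ℝ) = T := by exact_mod_cast hLT
    push_cast at this
    linarith
  have hTc : c ≤ T := Nat.le_ceil c
  have hLc : (L : ℝ) < c := by
    have h1 : (T : ℝ) < c + 1 := Nat.ceil_lt_add_one hcpos.le
    linarith
  have hcL1 : c - L ≤ 1 := by linarith
  -- `c - L ≥ 1/4`: `4 (c - L) = 3ℓ - 4T + 4` is a positive integer
  have hcL4 : (1 : ℝ) / 4 ≤ c - L := by
    have hz : (0 : ℝ) < ((3 * (ℓ : ℤ) - 4 * (T : ℤ) + 4 : ℤ) : ℝ) := by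
      push_cast
      rw [hc] at hLc
      linarith
    have hz' : (0 : ℤ) < 3 * (ℓ : ℤ) - 4 * (T : ℤ) + 4 := by exact_mod_cast hz
    have hz1 : (1 : ℤ) ≤ 3 * (ℓ : ℤ) - 4 * (T : ℤ) + 4 := hz'
    have hz1' : ((1 : ℤ) : ℝ) ≤ ((3 * (ℓ : ℤ) - 4 * (T : ℤ) + 4 : ℤ) : ℝ) := by exact_mod_cast hz1
    push_cast at hz1'
    rw [hc, hLreal]
    linarith
  have hr0 : 0 < r := by linarith
  have hr1 : 1 ≤ r := by linarith
  have hr2 : 2 ≤ r := by linarith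
  -- the width threshold `W` and `Q = W/2 + 1`
  set x : ℝ := (c - L) * r / 2 with hx
  have hxge : r / 8 ≤ x := by rw [hx]; nlinarith
  have hxle : x ≤ r / 2 := by rw [hx]; nlinarith
  have hxpos : 0 < x := by linarith
  set W : ℕ := ⌈x⌉₊ - 1 with hWdef
  have hW1 : 1 ≤ ⌈x⌉₊ := Nat.one_le_iff_ne_zero.2 (Nat.ceil_pos.2 hxpos).ne'
  have hWreal : (W : ℝ) = ⌈x⌉₊ - 1 := by
    have : ((W + 1 : ℕ) : ℝ) = ⌈x⌉₊ := by rw [hWdef]; exact_mod_cast Nat.sub_add_cancel hW1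
    push_cast at this
    linarith
  have hWx : (W : ℝ) < x := by
    have h1 : (⌈x⌉₊ : ℝ) < x + 1 := Nat.ceil_lt_add_one hxpos.le
    linarith
  have hWge : x - 1 ≤ W := by
    have h1 : x ≤ (⌈x⌉₊ : ℝ) := Nat.le_ceil x
    linarith
  have hq : r / 16 ≤ ((W / 2 + 1 : ℕ) : ℝ) := by
    have hdm := Nat.div_add_mod W 2
    have hmod : W % 2 ≤ 1 := Nat.lt_succ_iff.1 (Nat.mod_lt _ (by norm_num))
    have h1 : ((2 * (W / 2) + W % 2 : ℕ) : ℝ) = W := by exact_mod_cast hdm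
    have h2 : ((W % 2 : ℕ) : ℝ) ≤ 1 := by exact_mod_cast hmod
    push_cast at h1 ⊢
    linarith
  have hQle : ((W / 2 + 1 : ℕ) : ℝ) ≤ r / 2 := by
    have h1 : ((W / 2 : ℕ) : ℝ) ≤ (W : ℝ) / 2 := Nat.cast_div_le
    push_cast
    linarith
  -- the sampling rate `1/(K+1)`, `K + 1 = ⌈r^{1-ε}⌉`
  set K : ℕ := ⌈r ^ (1 - ε)⌉₊ - 1 with hKdef
  have hrpow : 0 < r ^ (1 - ε) := Real.rpow_pos_of_pos hr0 _
  have hK1 : 1 ≤ ⌈r ^ (1 - ε)⌉₊ := Nat.one_le_iff_ne_zero.2 (Nat.ceil_pos.2 hrpow).ne'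
  have hKeq : (K : ℝ) + 1 = ⌈r ^ (1 - ε)⌉₊ := by
    have : ((K + 1 : ℕ) : ℝ) = ⌈r ^ (1 - ε)⌉₊ := by
      rw [hKdef]; exact_mod_cast Nat.sub_add_cancel hK1
    push_cast at this
    exact this
  have hKge : r ^ (1 - ε) ≤ (K : ℝ) + 1 := by rw [hKeq]; exact Nat.le_ceil _
  have hK1' : (1 : ℝ) ≤ (K : ℝ) + 1 := by
    have : (0 : ℝ) ≤ K := Nat.cast_nonneg K
    linarith
  -- the family size `s = ⌊r^ε/(128 ℓ)⌋ + 1`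
  have hrε : 0 < r ^ ε := Real.rpow_pos_of_pos hr0 _
  set y : ℝ := r ^ ε / (128 * ℓ) with hy
  have hy0 : 0 ≤ y := by rw [hy]; positivity
  set s : ℕ := ⌊y⌋₊ + 1 with hsdef
  have hs1 : 1 ≤ s := Nat.le_add_left 1 _
  have hs_real : ((s - 1 : ℕ) : ℝ) ≤ y := by
    have : s - 1 = ⌊y⌋₊ := by rw [hsdef]; exact Nat.add_sub_cancel _ _
    rw [this]
    exact Nat.floor_le hy0
  have hsy : y ≤ s := by
    have h1 : y < (⌊y⌋₊ : ℝ) + 1 := Nat.lt_floor_add_one y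
    have h2 : ((s : ℕ) : ℝ) = (⌊y⌋₊ : ℝ) + 1 := by rw [hsdef]; push_cast; ring
    rw [h2]; exact h1.le
  have hrεr : r ^ ε ≤ r := by
    calc r ^ ε ≤ r ^ (1 : ℝ) := Real.rpow_le_rpow_of_exponent_le hr1 hε1.le
      _ = r := Real.rpow_one r
  have hyr : y ≤ r / 128 := by
    rw [hy, div_le_div_iff₀ (by positivity) (by norm_num)]
    nlinarith only [hrεr, hℓ', hr0.le]
  have hsr : (s : ℝ) ≤ r := by
    have h1 : ((s : ℕ) : ℝ) = ((s - 1 : ℕ) : ℝ) + 1 := by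
      have : ((s - 1 + 1 : ℕ) : ℝ) = s := by rw [Nat.sub_add_cancel hs1]
      push_cast at this
      linarith only [this]
    rw [h1]
    linarith only [hs_real, hyr, hr]
  -- the first term: `2^{ℓ(s-1)} ratio^Q ≤ exp(-r^ε/128)`
  have hKle : (K : ℝ) + 1 ≤ r ^ (1 - ε) + 1 := by
    rw [hKeq]; exact (Nat.ceil_lt_add_one hrpow.le).le
  have ht1 : (2 : ℝ) ^ (ℓ * (s - 1)) * ((2 * (K : ℝ) + 1) / (2 * K + 2)) ^ (W / 2 + 1)
      ≤ Real.exp (-(r ^ ε) / 128) := by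
    have hratio := ratio_pow_le_exp_neg (K := K) (q := W / 2 + 1) hr1 hε1.le hKle hq
    have h1 : ((ℓ * (s - 1) : ℕ) : ℝ) ≤ r ^ ε / 128 := by
      have hℓ0 : (0 : ℝ) ≤ ℓ := Nat.cast_nonneg ℓ
      have h2 : (ℓ : ℝ) * y = r ^ ε / 128 := by rw [hy]; field_simp
      push_cast
      calc (ℓ : ℝ) * ((s - 1 : ℕ) : ℝ) ≤ ℓ * y := mul_le_mul_of_nonneg_left hs_real hℓ0
        _ = r ^ ε / 128 := h2
    have hpow : (2 : ℝ) ^ (ℓ * (s - 1)) ≤ Real.exp (r ^ ε / 128) :=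
      calc (2 : ℝ) ^ (ℓ * (s - 1)) = (2 : ℝ) ^ (((ℓ * (s - 1) : ℕ) : ℝ)) := (Real.rpow_natCast _ _).symm
        _ ≤ (2 : ℝ) ^ (r ^ ε / 128) := Real.rpow_le_rpow_of_exponent_le (by norm_num) h1
        _ ≤ Real.exp (r ^ ε / 128) := two_rpow_le_exp (by positivity)
    calc (2 : ℝ) ^ (ℓ * (s - 1)) * ((2 * (K : ℝ) + 1) / (2 * K + 2)) ^ (W / 2 + 1)
        ≤ Real.exp (r ^ ε / 128) * Real.exp (-(r ^ ε) / 64) :=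
          mul_le_mul hpow hratio (by positivity) (by positivity)
      _ = Real.exp (-(r ^ ε) / 128) := by rw [← Real.exp_add]; congr 1; ring
  -- the second term: `(QΔ)^s 2^{ℓ s} / (K+1)^{j₀} ≤ 2^{-s}`
  have ht2 : (((W / 2 + 1) * Δ : ℕ) : ℝ) ^ s * (2 : ℝ) ^ (ℓ * s)
      / ((K : ℝ) + 1) ^ ((L + 1) * s + ⌈c * s⌉₊ - ℓ * s) ≤ (1 / 2 : ℝ) ^ s := by
    -- the exponent `j₀ ≥ ℓ s / 2`
    have hs0 : (0 : ℝ) ≤ s := Nat.cast_nonneg s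
    have hcs : c * s ≤ ⌈c * s⌉₊ := Nat.le_ceil _
    have hTs : (3 : ℝ) / 2 * ℓ * s ≤ T * s + c * s := by
      have h1 : c * s ≤ (T : ℝ) * s := mul_le_mul_of_nonneg_right hTc hs0
      have h2 : (3 : ℝ) / 2 * ℓ * s = c * s + c * s := by rw [hc]; ring
      linarith only [h1, h2]
    have hsum_ge : ℓ * s ≤ (L + 1) * s + ⌈c * s⌉₊ := by
      have h1 : ((ℓ * s : ℕ) : ℝ) ≤ (((L + 1) * s + ⌈c * s⌉₊ : ℕ) : ℝ) := by
        rw [hLT]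
        push_cast
        nlinarith only [hTs, hcs, hs0, hℓ']
      exact_mod_cast h1
    have hj₀ : (ℓ : ℝ) * s / 2 ≤ (((L + 1) * s + ⌈c * s⌉₊ - ℓ * s : ℕ) : ℝ) := by
      rw [Nat.cast_sub hsum_ge, hLT]
      push_cast
      linarith only [hTs, hcs]
    -- the base `QΔ2^ℓ ≤ r^{(1-ε)ℓ/2}/2`
    have hbase : (((W / 2 + 1) * Δ : ℕ) : ℝ) * (2 : ℝ) ^ ℓ ≤ r ^ ((1 - ε) * ℓ / 2) / 2 := by
      have h2ℓ : (0 : ℝ) < (2 : ℝ) ^ ℓ := by positivity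
      have hΔ' : (Δ : ℝ) * 2 ^ ℓ ≤ r ^ ((1 - ε) * ℓ / 2 - 1) := by
        rw [le_div_iff₀ h2ℓ] at hΔ; exact hΔ
      have hsplit : r ^ ((1 - ε) * ℓ / 2 - 1) * r = r ^ ((1 - ε) * ℓ / 2) := by
        rw [Real.rpow_sub_one hr0.ne']; field_simp
      have hra : 0 ≤ r ^ ((1 - ε) * ℓ / 2 - 1) := Real.rpow_nonneg hr0.le _
      rw [Nat.cast_mul]
      calc (((W / 2 + 1 : ℕ) : ℝ)) * (Δ : ℝ) * (2 : ℝ) ^ ℓ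
          = ((W / 2 + 1 : ℕ) : ℝ) * ((Δ : ℝ) * 2 ^ ℓ) := by ring
        _ ≤ (r / 2) * r ^ ((1 - ε) * ℓ / 2 - 1) :=
            mul_le_mul hQle hΔ' (by positivity) (by positivity)
        _ = r ^ ((1 - ε) * ℓ / 2) / 2 := by rw [← hsplit]; ring
    exact pow_mul_pow_div_le_half_pow hr0 hK1' hKge hj₀ hbase
  -- both terms are `≤ 2^{-y}`
  have hyε : y ≤ r ^ ε / 128 := by
    rw [hy, div_le_div_iff₀ (by positivity) (by norm_num)]
    nlinarith only [hrε.le, hℓ']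
  have hA : Real.exp (-(r ^ ε) / 128) ≤ (2 : ℝ) ^ (-y) := by
    have h1 : Real.exp (-(r ^ ε) / 128) ≤ Real.exp (-y) := by
      rw [Real.exp_le_exp]; rw [neg_div]; exact neg_le_neg hyε
    have h2 : Real.exp (-y) ≤ (2 : ℝ) ^ (-y) := by
      have h3 := two_rpow_le_exp hy0
      have h4 : (2 : ℝ) ^ (-y) = ((2 : ℝ) ^ y)⁻¹ := Real.rpow_neg (by norm_num) y
      rw [h4, Real.exp_neg, inv_le_inv₀ (Real.exp_pos y) (by positivity)]
      exact h3
    exact h1.trans h2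
  have hB : (1 / 2 : ℝ) ^ s ≤ (2 : ℝ) ^ (-y) := by
    have h1 : (1 / 2 : ℝ) ^ s = (2 : ℝ) ^ (-(s : ℝ)) := by
      rw [Real.rpow_neg (by norm_num), Real.rpow_natCast, one_div, inv_pow]
    rw [h1]
    exact Real.rpow_le_rpow_of_exponent_le (by norm_num) (neg_le_neg hsy)
  -- conclusion: the altered master inequality
  have hM := one_le_length_mul_alter E hexp hr2 K s hs1 hsr hsparse hcol hLc
    (by rw [← hx]; exact hWx) hπ
  have hsum : (2 : ℝ) ^ (ℓ * (s - 1)) * ((2 * (K : ℝ) + 1) / (2 * K + 2)) ^ (W / 2 + 1)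
      + (((W / 2 + 1) * Δ : ℕ) : ℝ) ^ s * (2 : ℝ) ^ (ℓ * s)
        / ((K : ℝ) + 1) ^ ((L + 1) * s + ⌈c * s⌉₊ - ℓ * s) ≤ 2 * (2 : ℝ) ^ (-y) := by
    linarith only [ht1.trans hA, ht2.trans hB]
  have hlen : (1 : ℝ) ≤ π.length * (2 * (2 : ℝ) ^ (-y)) :=
    hM.trans (mul_le_mul_of_nonneg_left hsum (Nat.cast_nonneg _))
  clear hM ht1 ht2 hsum
  have h2y : (0 : ℝ) < (2 : ℝ) ^ (-y) := Real.rpow_pos_of_pos (by norm_num) _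
  have hgoal : (2 : ℝ) ^ (r ^ ε / (128 * ℓ) - 1) = 1 / (2 * (2 : ℝ) ^ (-y)) := by
    rw [← hy, Real.rpow_sub (by norm_num : (0 : ℝ) < 2), Real.rpow_one, Real.rpow_neg (by norm_num)]
    field_simp
  rw [hgoal, div_le_iff₀ (by positivity)]
  exact hlen

/-- **The n-free exponential resolution law at polynomial column weight (crux-shaped form).**
For every locality `ℓ ≥ 1` and every column-weight exponent `0 ≤ a < ℓ/2 - 1` there are `ε > 0`
and `R` such that for all `r ≥ R`, all `n, m`, every `ℓ`-sparse `E : Fin m → LinEqMod 2 n` whose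
supports form an `(r, 3ℓ/4)`-boundary expander and each of whose variables lies in at most `r^a`
rows, every resolution refutation of `sumEncoding 1 E` has at least `2^{r^ε}` lines — uniformly
in `n` and `m`: the n-free exponential resolution rung of the expansion-scale law can only fail
through variables of column weight `r^{Ω(ℓ)}`.
[Ben-Sasson–Wigderson 2001, Thm. 6.5; Beame–Pitassi 1996; Alon–Spencer §3; Krajíček 2019, §13.4,
Problem 19.4.5] [folklore] -/
theorem resolution_size_column_pow (ℓ : ℕ) (hℓ : 1 ≤ ℓ) (a : ℝ) (ha : 0 ≤ a)
    (hal : a < (ℓ : ℝ) / 2 - 1) :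
    ∃ ε : ℝ, 0 < ε ∧ ∃ R : ℝ, ∀ r : ℝ, R ≤ r → ∀ (n m : ℕ) (E : Fin m → LinEqMod 2 n),
      (∀ i, (E i).supp.card ≤ ℓ) →
      IsBoundaryExpander (fun i => (E i).supp.map Fin.valEmbedding) r (3 / 4 * ℓ) →
      (∀ j : Fin n, (((univ : Finset (Fin m)).filter fun i => j ∈ (E i).supp).card : ℝ) ≤ r ^ a) →
      ∀ π : List (ResLine ℕ), IsResRefutation (sumEncoding 1 E) π →
        (2 : ℝ) ^ (r ^ ε) ≤ (π.length : ℝ) := by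
  -- the exponent gap
  set ε₀ : ℝ := ((ℓ : ℝ) / 2 - 1 - a) / ℓ with hε₀
  have hℓ' : (1 : ℝ) ≤ ℓ := by exact_mod_cast hℓ
  have hℓ0 : (0 : ℝ) < ℓ := by linarith
  have hgap : 0 < (ℓ : ℝ) / 2 - 1 - a := by linarith
  have hε₀pos : 0 < ε₀ := by rw [hε₀]; positivity
  have hε₀lt : ε₀ < 1 := by
    rw [hε₀, div_lt_one hℓ0]; linarith
  set δ : ℝ := ((ℓ : ℝ) / 2 - 1 - a) / 2 with hδ
  have hδpos : 0 < δ := by rw [hδ]; positivity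
  have hexpo : (1 - ε₀) * ℓ / 2 - 1 = a + δ := by
    rw [hε₀, hδ]; field_simp; ring
  refine ⟨ε₀ / 2, by positivity, ?_⟩
  -- eventual conditions on `r`
  have hev1 : ∀ᶠ r : ℝ in atTop, (2 : ℝ) ^ ℓ ≤ r ^ δ :=
    (tendsto_rpow_atTop hδpos).eventually (eventually_ge_atTop _)
  have hev2 : ∀ᶠ r : ℝ in atTop, 128 * (ℓ : ℝ) + 1 ≤ r ^ (ε₀ / 2) :=
    (tendsto_rpow_atTop (by positivity)).eventually (eventually_ge_atTop _)
  obtain ⟨R, hR⟩ := Filter.eventually_atTop.1 ((hev1.and hev2).and (eventually_ge_atTop (4 : ℝ)))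
  refine ⟨R, fun r hr n m E hsparse hexp hcol π hπ => ?_⟩
  obtain ⟨⟨hr1, hr2⟩, hr4⟩ := hR r hr
  have hr0 : 0 < r := by linarith
  -- column weight `≤ r^a ≤ r^{(1-ε₀)ℓ/2-1}/2^ℓ`
  set Δ : ℕ := ⌊r ^ a⌋₊ with hΔdef
  have hcolΔ : ∀ j : Fin n, ((univ : Finset (Fin m)).filter fun i => j ∈ (E i).supp).card ≤ Δ := by
    intro j
    rw [hΔdef]
    exact Nat.le_floor (hcol j)
  have hΔ : (Δ : ℝ) ≤ r ^ ((1 - ε₀) * ℓ / 2 - 1) / 2 ^ ℓ := by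
    rw [hexpo, le_div_iff₀ (by positivity), Real.rpow_add hr0]
    have h1 : (Δ : ℝ) ≤ r ^ a := Nat.floor_le (Real.rpow_nonneg hr0.le a)
    exact mul_le_mul h1 hr1 (by positivity) (Real.rpow_nonneg hr0.le a)
  have hmain := resolution_size_nfree_column ℓ hℓ ε₀ hε₀pos hε₀lt r hr4 n m Δ E hsparse hexp hcolΔ
    hΔ π hπ
  -- `r^{ε₀/2} ≤ r^{ε₀}/(128 ℓ) - 1`
  have hz : r ^ (ε₀ / 2) ≤ r ^ ε₀ / (128 * ℓ) - 1 := by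
    set z : ℝ := r ^ (ε₀ / 2) with hz
    have hzz : r ^ ε₀ = z * z := by
      rw [hz, ← Real.rpow_add hr0]; congr 1; ring
    rw [hzz, le_sub_iff_add_le, le_div_iff₀ (by positivity)]
    have hz1 : 128 * (ℓ : ℝ) + 1 ≤ z := hr2
    have hz0 : 0 ≤ z := by rw [hz]; exact Real.rpow_nonneg hr0.le _
    nlinarith only [hz1, hz0, hℓ']
  calc (2 : ℝ) ^ (r ^ (ε₀ / 2)) ≤ (2 : ℝ) ^ (r ^ ε₀ / (128 * ℓ) - 1) :=
        Real.rpow_le_rpow_of_exponent_le (by norm_num) hz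
    _ ≤ (π.length : ℝ) := hmain

end Summit.PneNP.PneNP.Theorems.ResNFree
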